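import Literature.Geometry.Kaehler.ComplexTorusEffectiveClassesProduct
import Literature.Geometry.Kaehler.ComplexTorusPicardNumberPoincareLength
import HarnessLib

/-!
# Bauer 1998, Thm. 4.2 as printed: along a Poincaré decomposition `X ∼ X₁^{n₁} × ⋯ × X_r^{n_r}`, the
# semigroup `N(X)` of effective classes is finitely generated iff `NS(Xᵢ) ≅ ℤ` and `nᵢ = 1` for all `i`

Layer `Literature/Geometry/Kaehler`, namespace `Literature.Geometry.Kaehler.ComplexTorus`; lane
`lit-hodgefound`, seat p07 (generation 44), programme «THE NEF CONE OF AN ABELIAN VARIETY», file 54 of the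
seat lineage and the closing file of the Bauer 1998 series: `ComplexTorusNefConePolyhedralSimple` (file 50:
Prop. 2.2, a simple abelian variety has finitely generated `N` iff `NS ≅ ℤ`),
`ComplexTorusEffectiveClassesIsogeny` (file 51: Lemma 4.1, isogeny invariance),
`ComplexTorusEffectiveClassesSelfProduct` (file 52: Prop. 3.1, `N(X × X)` is never finitely generated),
`ComplexTorusEffectiveClassesProduct` (file 53: two factors — finite generation descends to the factors of
`X₁ × X₂` and ascends when `Hom(X₂, X₁) = 0`).  The finite products of tori of arbitrary dimensions are the
dependent products `∏_k X_k = ComplexTorus (sigmaPiPeriod Ψ)` of `ComplexTorusPoincareCompleteReducibilityIsogeny`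
(seat p10) with the splitting isomorphisms `isIsomorphic_sigmaPiPeriod_sumEquiv / _unique / _succ / _compEquiv`
and `finrank_homRat_sigmaPiPeriod_right/left` of `ComplexTorusPicardNumberPoincareLength` /
`ComplexTorusPoincareCompleteReducibilityUniqueness` (seat p18 / p10), the power isomorphisms
`isIsomorphic_powPeriod_one`, `isIsomorphic_powPeriod_succ`, `isIsomorphic_prodPeriod_powPeriod_add`
(`ComplexTorusProductPowerIsomorphisms`), `IsIsogenous.sigmaPi` (`ComplexTorusPoincareCompleteReducibilityPowers`)
and `IsAbelianVariety.sigmaPi`, `IsAbelianVariety.of_isIsogenous_powers`, `finrank_pos_of_nonempty` — all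
consumed BY NAME.  A Poincaré decomposition is carried, as everywhere in the lane
(`ComplexTorusPicardNumberPoincareLength`), as an abstract isogeny
`X ∼ ∏_ν X_ν^{n_ν} = ComplexTorus (sigmaPiPeriod fun ν ↦ powPeriod (X ν) (n ν))` with simple, nonzero
(`Nonempty (τ ν)`), pairwise non-isogenous `X_ν` and `n_ν ≥ 1`; it exists by
`poincare_complete_reducibility_powers` and is unique (`ComplexTorusPoincareCompleteReducibilityUniqueness`).
Theorems only (no definition, no named fact, no instance, no notation; net debt `0`).

THE SOURCE (Th. Bauer, *On the cone of curves of an abelian variety*, Amer. J. Math. 120 (1998), §4; held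
arXiv alg-geom/9712019, p. 5), VERBATIM. "Finally, consider an arbitrary abelian variety `X`. It is isogenous
to a product `X₁^{n₁} × … × X_r^{n_r}` with integers `nᵢ ≥ 1`, where the `Xᵢ` are simple and mutually
non-isogenous […] **Theorem 4.2** The semi-group `N(X)` is finitely generated if and only if `NS(Xᵢ) ≅ ℤ`
and `nᵢ = 1` for `1 ≤ i ≤ r`. *Proof.* Suppose first that `NS(Xᵢ) ≅ ℤ` and `nᵢ = 1` for `1 ≤ i ≤ r`. By
Lemma 4.1 we may assume that `X` is the product `X₁ × … × X_r`. […] Due to the fact that the `Xᵢ` are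
non-isogenous, we have `NS_ℚ(∏ Xᵢ) ≅ […] ≅ ⊕ NS_ℚ(Xᵢ)`. Therefore `N(X) = ⊕ ℤ⁺·[Nᵢ]` is finitely
generated. Conversely, assume that `N(X)` is finitely generated. Note that if `V₁` and `V₂` are varieties
such that `N(V₁ × V₂)` is finitely generated, then `N(V₁)` and `N(V₂)` are finitely generated as well. So in
particular Proposition 2.2 applies to the factors `Xᵢ` and shows that we have `NS(Xᵢ) ≅ ℤ` for all `i`.
Further, if we had `nᵢ > 1` for some `i` […] then `N(Xᵢ × Xᵢ)` would be finitely generated, which however is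
impossible according to Proposition 3.1. This completes the proof of the theorem."

THIS FILE (`N(X) = {η ∈ NS(X) | H_η ≥ 0}`, the semi-positive = effective = nef classes, as in files 50–53):
* §1 finite products: the empty product (`exists_finset_addSubmonoidClosure_eq_of_subsingleton`), and
  **descent of finite generation to every factor and to every pair of factors**
  (`exists_finset_addSubmonoidClosure_eq_of_sigmaPi`, `…_prod_of_sigmaPi` — "if `N(V₁ × V₂)` is finitely
  generated, then `N(V₁)` and `N(V₂)` are", iterated along the block splittings of `∏_k X_k`) — all tori;
* §2 powers: **`IsAbelianVariety.not_exists_finset_addSubmonoidClosure_eq_powPeriod`** — `N(Xⁿ)` is not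
  finitely generated for an abelian variety `X ≠ 0` and `n ≥ 2` ("if we had `nᵢ > 1` […] impossible
  according to Proposition 3.1": `Xⁿ ≅ X^{n−2} × X²`, `X² ≅ X × X`);
* §3 ascent: **`exists_finset_addSubmonoidClosure_eq_sigmaPi_of_forall_homRat_eq_bot`** — for abelian
  varieties `X_k` with `Hom_ℚ(X_j, X_k) = 0` (`j ≠ k`) and every `N(X_k)` finitely generated, `N(∏_k X_k)` is
  finitely generated ("`N(X) = ⊕ ℤ⁺·[Nᵢ]`": induction on the number of factors with file 53's two-factor
  ascent and `Hom_ℚ(X_n, ∏_{k<n} X_k) = ⊕_k Hom_ℚ(X_n, X_k) = 0`);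
* §4 **THM. 4.2**: `IsSimple.exists_finset_addSubmonoidClosure_eq_sigmaPi_iff` (for simple abelian varieties
  `X_k ≠ 0`: `N(∏_k X_k)` finitely generated iff the `X_k` are pairwise non-isogenous with `rk NS(X_k) = 1`),
  **`exists_finset_addSubmonoidClosure_eq_powers_iff`** (`N(∏_ν X_ν^{n_ν})` finitely generated iff
  `rk NS(X_ν) = 1` and `n_ν = 1` for all `ν`) and, AS PRINTED, along a Poincaré decomposition of an arbitrary
  abelian variety **`IsAbelianVariety.exists_finset_addSubmonoidClosure_eq_iff_of_isIsogenous_powers`**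
  (the factors' projectivity derived from `X`'s, `IsAbelianVariety.of_isIsogenous_powers`), with the
  isogeny-class forms `IsIsogenous.exists_finset_addSubmonoidClosure_eq_iff_of_sigmaPi / _of_powers`.

## References

* [Bauer1998ConeOfCurves] Th. Bauer, *On the cone of curves of an abelian variety*, Amer. J. Math. 120 (1998)
  997–1006, §4 Thm. 4.2 with proof, Lemma 4.1, §3 Prop. 3.1, §2 Prop. 2.2, §1 Theorem (ic) ⟺ (ii) (held:
  arXiv alg-geom/9712019, pp. 1–5).
* [Lange2023AbelianVarietiesComplex] H. Lange, *Abelian Varieties over the Complex Numbers*, Springer 2023,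
  §2.4.4 Thm. 2.4.25 (Poincaré's complete reducibility `X ∼ X₁^{n₁} × ⋯ × X_r^{n_r}`), Cor. 2.4.26
  (`Hom(X_ν, X_μ) = 0` for non-isogenous simple factors), §1.1.2 (products).
* [Milne1999LefschetzClasses] J. S. Milne, *Lefschetz classes on abelian varieties*, Duke Math. J. 96 (1999),
  §4 Cor. 4.2 (`Hom(A, B) = 0 ⟹ DC(A, B) = 0`).
-/

noncomputable section

open scoped Manifold ComplexOrder NNReal
open Complex Set Function Module Filter Topology

namespace Literature.Geometry.Kaehler

namespace ComplexTorus

/-! ### §1 Finite products: the empty product, descent to factors and to pairs of factors -/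

section Empty

variable {ι : Type*} [Fintype ι] [DecidableEq ι] {E : Type*} [NormedAddCommGroup E] [NormedSpace ℂ E]

omit [Fintype ι] [DecidableEq ι] in
/-- **The zero torus**: on a zero-dimensional torus every `2`-form vanishes, so `N(0) = {0}` is finitely
generated (by the empty set) — the empty product in Thm. 4.2. [cite: Bauer1998ConeOfCurves, §4 Thm. 4.2 (the case `r = 0`)] -/
theorem exists_finset_addSubmonoidClosure_eq_of_subsingleton [Subsingleton E] (Φ : (ι → ℝ) ≃L[ℝ] E) :
    ∃ S : Finset (E [⋀^Fin 2]→L[ℝ] ℝ),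
      (AddSubmonoid.closure (S : Set (E [⋀^Fin 2]→L[ℝ] ℝ)) : Set (E [⋀^Fin 2]→L[ℝ] ℝ)) =
        {η | IsNSForm Φ η ∧ ∀ v : E, 0 ≤ η ![I • v, v]} := by
  have hzero : ∀ η : E [⋀^Fin 2]→L[ℝ] ℝ, η = 0 := fun η ↦ by
    ext v
    have hv : v = 0 := Subsingleton.elim _ _
    rw [hv, ContinuousAlternatingMap.coe_zero, Pi.zero_apply]
    exact η.map_zero
  refine ⟨∅, Set.Subset.antisymm ?_ ?_⟩
  · intro η _
    rw [hzero η]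
    refine ⟨(neronSeveriGroup Φ).zero_mem, fun v ↦ ?_⟩
    rw [ContinuousAlternatingMap.coe_zero, Pi.zero_apply]
  · intro η _
    rw [hzero η]
    exact (AddSubmonoid.closure _).zero_mem

end Empty

section Descend

variable {κ : Type*} [Fintype κ] [DecidableEq κ] {σ : κ → Type*} [∀ k, Fintype (σ k)]
  [∀ k, DecidableEq (σ k)] {F : κ → Type*} [∀ k, NormedAddCommGroup (F k)] [∀ k, NormedSpace ℂ (F k)]
  (Ψ : ∀ k, (σ k → ℝ) ≃L[ℝ] F k)

/-- Descent of finite generation of `N` to the two blocks of a splitting `∏_κ X ≅ ∏_{κ₁} X × ∏_{κ₂} X`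
(Lemma 4.1 for the splitting isomorphism, then the two-factor descent of file 53). [cite: Bauer1998ConeOfCurves, §4 Thm. 4.2 (proof, "only if")] -/
private theorem exists_finset_addSubmonoidClosure_eq_of_sumEquiv {κ₁ κ₂ : Type*} [Fintype κ₁] [Fintype κ₂]
    [DecidableEq κ₁] [DecidableEq κ₂] (e : κ ≃ κ₁ ⊕ κ₂)
    (h : ∃ S : Finset ((∀ k, F k) [⋀^Fin 2]→L[ℝ] ℝ),
      (AddSubmonoid.closure (S : Set ((∀ k, F k) [⋀^Fin 2]→L[ℝ] ℝ)) : Set ((∀ k, F k) [⋀^Fin 2]→L[ℝ] ℝ)) =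
        {η | IsNSForm (sigmaPiPeriod Ψ) η ∧ ∀ v : ∀ k, F k, 0 ≤ η ![I • v, v]}) :
    (∃ S₁ : Finset ((∀ i : κ₁, F (e.symm (Sum.inl i))) [⋀^Fin 2]→L[ℝ] ℝ),
      (AddSubmonoid.closure (S₁ : Set ((∀ i : κ₁, F (e.symm (Sum.inl i))) [⋀^Fin 2]→L[ℝ] ℝ)) :
          Set ((∀ i : κ₁, F (e.symm (Sum.inl i))) [⋀^Fin 2]→L[ℝ] ℝ)) =
        {η | IsNSForm (sigmaPiPeriod fun i : κ₁ ↦ Ψ (e.symm (Sum.inl i))) η ∧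
          ∀ v : ∀ i : κ₁, F (e.symm (Sum.inl i)), 0 ≤ η ![I • v, v]}) ∧
    (∃ S₂ : Finset ((∀ j : κ₂, F (e.symm (Sum.inr j))) [⋀^Fin 2]→L[ℝ] ℝ),
      (AddSubmonoid.closure (S₂ : Set ((∀ j : κ₂, F (e.symm (Sum.inr j))) [⋀^Fin 2]→L[ℝ] ℝ)) :
          Set ((∀ j : κ₂, F (e.symm (Sum.inr j))) [⋀^Fin 2]→L[ℝ] ℝ)) =
        {η | IsNSForm (sigmaPiPeriod fun j : κ₂ ↦ Ψ (e.symm (Sum.inr j))) η ∧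
          ∀ v : ∀ j : κ₂, F (e.symm (Sum.inr j)), 0 ≤ η ![I • v, v]}) := by
  obtain ⟨S, hS⟩ :=
    ((isIsomorphic_sigmaPiPeriod_sumEquiv Ψ e).isIsogenous.exists_finset_addSubmonoidClosure_eq_iff _ _).1 h
  exact ⟨exists_finset_addSubmonoidClosure_eq_left_of_prod _ _ hS,
    exists_finset_addSubmonoidClosure_eq_right_of_prod _ _ hS⟩

/-- **"If `N(V₁ × V₂)` is finitely generated, then `N(V₁)` and `N(V₂)` are finitely generated as well" —
for every factor of a finite product**: if `N(∏_k X_k)` is finitely generated then so is every `N(X_k)`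
(split `∏_k X_k ≅ X_k × ∏_{j ≠ k} X_j`). For all complex tori. [cite: Bauer1998ConeOfCurves, §4 Thm. 4.2 (proof, "only if")] -/
theorem exists_finset_addSubmonoidClosure_eq_of_sigmaPi
    (h : ∃ S : Finset ((∀ k, F k) [⋀^Fin 2]→L[ℝ] ℝ),
      (AddSubmonoid.closure (S : Set ((∀ k, F k) [⋀^Fin 2]→L[ℝ] ℝ)) : Set ((∀ k, F k) [⋀^Fin 2]→L[ℝ] ℝ)) =
        {η | IsNSForm (sigmaPiPeriod Ψ) η ∧ ∀ v : ∀ k, F k, 0 ≤ η ![I • v, v]}) (k : κ) :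
    ∃ S : Finset (F k [⋀^Fin 2]→L[ℝ] ℝ),
      (AddSubmonoid.closure (S : Set (F k [⋀^Fin 2]→L[ℝ] ℝ)) : Set (F k [⋀^Fin 2]→L[ℝ] ℝ)) =
        {η | IsNSForm (Ψ k) η ∧ ∀ v : F k, 0 ≤ η ![I • v, v]} := by
  classical
  obtain ⟨h₁, -⟩ := exists_finset_addSubmonoidClosure_eq_of_sumEquiv Ψ (Equiv.sumCompl fun i ↦ i = k).symm h
  exact ((isIsomorphic_sigmaPiPeriod_unique fun i : {i // i = k} ↦
    Ψ ((Equiv.sumCompl fun i ↦ i = k).symm.symm (Sum.inl i))).isIsogenous.exists_finset_addSubmonoidClosure_eq_iff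
      _ _).1 h₁

/-- **… and to every pair of factors**: if `N(∏_k X_k)` is finitely generated then so is `N(X_j × X_k)` for
`j ≠ k` (split `∏ X ≅ (∏_{i ∈ {j,k}} X_i) × ∏_{i ∉ {j,k}} X_i` and `∏_{i ∈ {j,k}} X_i ≅ X_j × X_k`).
[cite: Bauer1998ConeOfCurves, §4 Thm. 4.2 (proof, "only if": "`N(Xᵢ × Xᵢ)` would be finitely generated")] -/
theorem exists_finset_addSubmonoidClosure_eq_prod_of_sigmaPi
    (h : ∃ S : Finset ((∀ k, F k) [⋀^Fin 2]→L[ℝ] ℝ),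
      (AddSubmonoid.closure (S : Set ((∀ k, F k) [⋀^Fin 2]→L[ℝ] ℝ)) : Set ((∀ k, F k) [⋀^Fin 2]→L[ℝ] ℝ)) =
        {η | IsNSForm (sigmaPiPeriod Ψ) η ∧ ∀ v : ∀ k, F k, 0 ≤ η ![I • v, v]}) {j k : κ} (hjk : j ≠ k) :
    ∃ S : Finset ((F j × F k) [⋀^Fin 2]→L[ℝ] ℝ),
      (AddSubmonoid.closure (S : Set ((F j × F k) [⋀^Fin 2]→L[ℝ] ℝ)) : Set ((F j × F k) [⋀^Fin 2]→L[ℝ] ℝ)) =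
        {η | IsNSForm (prodPeriod (Ψ j) (Ψ k)) η ∧ ∀ v : F j × F k, 0 ≤ η ![I • v, v]} := by
  classical
  obtain ⟨h₁, -⟩ :=
    exists_finset_addSubmonoidClosure_eq_of_sumEquiv Ψ (Equiv.sumCompl fun i ↦ i = j ∨ i = k).symm h
  -- the two-element block `{j, k}` splits as `{j} ⊔ {k}`
  let e' : {i // i = j ∨ i = k} ≃ {i // i = j} ⊕ {i // i = k} :=
    { toFun := fun t ↦ if ht : (t : κ) = j then Sum.inl ⟨t, ht⟩ else Sum.inr ⟨t, t.2.resolve_left ht⟩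
      invFun := Sum.elim (fun a ↦ ⟨a, Or.inl a.2⟩) (fun b ↦ ⟨b, Or.inr b.2⟩)
      left_inv := fun t ↦ by
        show Sum.elim (fun a : {i // i = j} ↦ (⟨a, Or.inl a.2⟩ : {i // i = j ∨ i = k}))
            (fun b : {i // i = k} ↦ ⟨b, Or.inr b.2⟩)
            (if ht : (t : κ) = j then Sum.inl ⟨t, ht⟩ else Sum.inr ⟨t, t.2.resolve_left ht⟩) = t
        by_cases ht : (t : κ) = j
        · simp only [dif_pos ht, Sum.elim_inl, Subtype.coe_eta]
        · simp only [dif_neg ht, Sum.elim_inr, Subtype.coe_eta]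
      right_inv := fun s ↦ by
        rcases s with a | b
        · exact dif_pos a.2
        · exact dif_neg fun hb : (b : κ) = j ↦ hjk (hb.symm.trans b.2) }
  have iso := ((isIsomorphic_sigmaPiPeriod_sumEquiv
      (fun t : {i // i = j ∨ i = k} ↦ Ψ ((Equiv.sumCompl fun i ↦ i = j ∨ i = k).symm.symm (Sum.inl t))) e').trans
    ((isIsomorphic_sigmaPiPeriod_unique fun a : {i // i = j} ↦
        Ψ ((Equiv.sumCompl fun i ↦ i = j ∨ i = k).symm.symm (Sum.inl (e'.symm (Sum.inl a))))).prod
      (isIsomorphic_sigmaPiPeriod_unique fun b : {i // i = k} ↦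
        Ψ ((Equiv.sumCompl fun i ↦ i = j ∨ i = k).symm.symm (Sum.inl (e'.symm (Sum.inr b))))))).isIsogenous
  exact (iso.exists_finset_addSubmonoidClosure_eq_iff _ _).1 h₁

end Descend

/-! ### §2 "If we had `nᵢ > 1` … impossible according to Proposition 3.1": `N(Xⁿ)`, `n ≥ 2` -/

section Powers

variable {ι : Type*} [Fintype ι] [DecidableEq ι] {E : Type*} [NormedAddCommGroup E] [NormedSpace ℂ E]
  (Φ : (ι → ℝ) ≃L[ℝ] E)

/-- **`N(Xⁿ)` is not finitely generated for an abelian variety `X ≠ 0` and `n ≥ 2`**: `Xⁿ ≅ X^{n−2} × X²`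
and `X² ≅ X × X`, so `N(X × X)` would be finitely generated (descent), against Prop. 3.1 (file 52).
[cite: Bauer1998ConeOfCurves, §4 Thm. 4.2 (proof, "only if") and §3 Prop. 3.1] -/
theorem IsAbelianVariety.not_exists_finset_addSubmonoidClosure_eq_powPeriod [Nontrivial E]
    (hX : IsAbelianVariety Φ) {n : ℕ} (hn : 2 ≤ n) :
    ¬ ∃ S : Finset ((Fin n → E) [⋀^Fin 2]→L[ℝ] ℝ),
      (AddSubmonoid.closure (S : Set ((Fin n → E) [⋀^Fin 2]→L[ℝ] ℝ)) : Set ((Fin n → E) [⋀^Fin 2]→L[ℝ] ℝ)) =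
        {η | IsNSForm (powPeriod Φ n) η ∧ ∀ v : Fin n → E, 0 ≤ η ![I • v, v]} := by
  obtain ⟨m, rfl⟩ := Nat.exists_eq_add_of_le' hn
  intro h
  -- `X^{m+2} ≅ Xᵐ × X²`
  obtain ⟨S, hS⟩ := ((isIsomorphic_prodPeriod_powPeriod_add Φ m 2).symm.isIsogenous
    |>.exists_finset_addSubmonoidClosure_eq_iff _ _).1 h
  -- descent to `X²`, and `X² ≅ X¹ × X ≅ X × X`
  have h₂ := exists_finset_addSubmonoidClosure_eq_right_of_prod _ _ hS
  have iso : IsIsogenous (powPeriod Φ 2) (prodPeriod Φ Φ) :=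
    ((isIsomorphic_powPeriod_succ Φ 1).trans
      ((isIsomorphic_powPeriod_one Φ).symm.prod (IsIsomorphic.refl Φ))).isIsogenous
  exact iso.not_exists_finset_addSubmonoidClosure_eq_of_prod Φ hX h₂

/-- `N(X¹)` finitely generated is `N(X)` finitely generated (`X ≅ X¹`). [cite: Bauer1998ConeOfCurves, §4 Lemma 4.1] -/
private theorem exists_finset_addSubmonoidClosure_eq_of_powPeriod_of_eq_one {n : ℕ} (hn : n = 1)
    (h : ∃ S : Finset ((Fin n → E) [⋀^Fin 2]→L[ℝ] ℝ),
      (AddSubmonoid.closure (S : Set ((Fin n → E) [⋀^Fin 2]→L[ℝ] ℝ)) : Set ((Fin n → E) [⋀^Fin 2]→L[ℝ] ℝ)) =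
        {η | IsNSForm (powPeriod Φ n) η ∧ ∀ v : Fin n → E, 0 ≤ η ![I • v, v]}) :
    ∃ S : Finset (E [⋀^Fin 2]→L[ℝ] ℝ),
      (AddSubmonoid.closure (S : Set (E [⋀^Fin 2]→L[ℝ] ℝ)) : Set (E [⋀^Fin 2]→L[ℝ] ℝ)) =
        {η | IsNSForm Φ η ∧ ∀ v : E, 0 ≤ η ![I • v, v]} := by
  subst hn
  exact ((isIsomorphic_powPeriod_one Φ).isIsogenous.exists_finset_addSubmonoidClosure_eq_iff _ _).2 h

end Powers

/-! ### §3 Ascent: `N(∏_k X_k) = ⊕_k p_k^* N(X_k)` is finitely generated when the `N(X_k)` are and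
`Hom(X_j, X_k) = 0` for `j ≠ k` -/

section Ascend

/-- Ascent over `Fin m`-indexed families, by induction on `m` (`∏_{k ≤ m} X_k ≅ (∏_{k < m} X_k) × X_m`,
`Hom_ℚ(X_m, ∏_{k<m} X_k) = ⊕_k Hom_ℚ(X_m, X_k) = 0`, two-factor ascent of file 53, Lemma 4.1).
[cite: Bauer1998ConeOfCurves, §4 Thm. 4.2 (proof, "if")] -/
private theorem exists_finset_addSubmonoidClosure_eq_sigmaPi_fin :
    ∀ {m : ℕ} {σ : Fin m → Type*} [∀ k, Fintype (σ k)] [∀ k, DecidableEq (σ k)] {F : Fin m → Type*}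
      [∀ k, NormedAddCommGroup (F k)] [∀ k, NormedSpace ℂ (F k)] (Ψ : ∀ k, (σ k → ℝ) ≃L[ℝ] F k),
      (∀ k, IsAbelianVariety (Ψ k)) → (∀ j k, j ≠ k → homRat (Ψ j) (Ψ k) = ⊥) →
      (∀ k, ∃ S : Finset (F k [⋀^Fin 2]→L[ℝ] ℝ),
        (AddSubmonoid.closure (S : Set (F k [⋀^Fin 2]→L[ℝ] ℝ)) : Set (F k [⋀^Fin 2]→L[ℝ] ℝ)) =
          {η | IsNSForm (Ψ k) η ∧ ∀ v : F k, 0 ≤ η ![I • v, v]}) →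
      ∃ S : Finset ((∀ k, F k) [⋀^Fin 2]→L[ℝ] ℝ),
        (AddSubmonoid.closure (S : Set ((∀ k, F k) [⋀^Fin 2]→L[ℝ] ℝ)) : Set ((∀ k, F k) [⋀^Fin 2]→L[ℝ] ℝ)) =
          {η | IsNSForm (sigmaPiPeriod Ψ) η ∧ ∀ v : ∀ k, F k, 0 ≤ η ![I • v, v]}
  | 0, σ, _, _, F, _, _, Ψ, _, _, _ => by
    haveI : Unique (∀ k : Fin 0, F k) := Pi.uniqueOfIsEmpty _
    exact exists_finset_addSubmonoidClosure_eq_of_subsingleton _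
  | m + 1, σ, _, _, F, _, _, Ψ, hA, hHom, hfg => by
    classical
    obtain ⟨S₁, hS₁⟩ := exists_finset_addSubmonoidClosure_eq_sigmaPi_fin (fun k : Fin m ↦ Ψ k.castSucc)
      (fun k ↦ hA _) (fun j k hjk ↦ hHom _ _ fun h ↦ hjk (Fin.castSucc_injective m h)) fun k ↦ hfg _
    obtain ⟨S₂, hS₂⟩ := hfg (Fin.last m)
    -- `Hom_ℚ(X_m, ∏_{k<m} X_k) = 0`
    have hHom' : homRat (Ψ (Fin.last m)) (sigmaPiPeriod fun k : Fin m ↦ Ψ k.castSucc) = ⊥ := by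
      rw [← Submodule.finrank_eq_zero, finrank_homRat_sigmaPiPeriod_right]
      refine Finset.sum_eq_zero fun k _ ↦ ?_
      rw [Submodule.finrank_eq_zero]
      exact hHom _ _ (Fin.castSucc_lt_last k).ne'
    have hprod := (IsAbelianVariety.sigmaPi fun k : Fin m ↦ hA k.castSucc)
      |>.exists_finset_addSubmonoidClosure_eq_prod_of_homRat_eq_bot
        (sigmaPiPeriod fun k : Fin m ↦ Ψ k.castSucc) (Ψ (Fin.last m)) hHom' hS₁ hS₂
    exact ((isIsomorphic_sigmaPiPeriod_succ Ψ).isIsogenous.exists_finset_addSubmonoidClosure_eq_iff _ _).2 hprod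

variable {κ : Type*} [Fintype κ] [DecidableEq κ] {σ : κ → Type*} [∀ k, Fintype (σ k)]
  [∀ k, DecidableEq (σ k)] {F : κ → Type*} [∀ k, NormedAddCommGroup (F k)] [∀ k, NormedSpace ℂ (F k)]
  (Ψ : ∀ k, (σ k → ℝ) ≃L[ℝ] F k)

/-- **"Therefore `N(X) = ⊕ᵢ ℤ⁺·[Nᵢ]` is finitely generated" — ascent of finite generation to a finite
product**: for abelian varieties `X_k` with `Hom_ℚ(X_j, X_k) = 0` for `j ≠ k` (e.g. simple and pairwise
non-isogenous), if every `N(X_k)` is finitely generated then `N(∏_k X_k)` is finitely generated.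
[cite: Bauer1998ConeOfCurves, §4 Thm. 4.2 (proof, "if")] [cite: Milne1999LefschetzClasses, §4 Cor. 4.2] -/
theorem exists_finset_addSubmonoidClosure_eq_sigmaPi_of_forall_homRat_eq_bot (hA : ∀ k, IsAbelianVariety (Ψ k))
    (hHom : ∀ j k, j ≠ k → homRat (Ψ j) (Ψ k) = ⊥)
    (hfg : ∀ k, ∃ S : Finset (F k [⋀^Fin 2]→L[ℝ] ℝ),
      (AddSubmonoid.closure (S : Set (F k [⋀^Fin 2]→L[ℝ] ℝ)) : Set (F k [⋀^Fin 2]→L[ℝ] ℝ)) =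
        {η | IsNSForm (Ψ k) η ∧ ∀ v : F k, 0 ≤ η ![I • v, v]}) :
    ∃ S : Finset ((∀ k, F k) [⋀^Fin 2]→L[ℝ] ℝ),
      (AddSubmonoid.closure (S : Set ((∀ k, F k) [⋀^Fin 2]→L[ℝ] ℝ)) : Set ((∀ k, F k) [⋀^Fin 2]→L[ℝ] ℝ)) =
        {η | IsNSForm (sigmaPiPeriod Ψ) η ∧ ∀ v : ∀ k, F k, 0 ≤ η ![I • v, v]} := by
  classical
  let e : Fin (Fintype.card κ) ≃ κ := (Fintype.equivFin κ).symm
  have h := exists_finset_addSubmonoidClosure_eq_sigmaPi_fin (fun k ↦ Ψ (e k)) (fun k ↦ hA _)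
    (fun j k hjk ↦ hHom _ _ (e.injective.ne hjk)) fun k ↦ hfg _
  exact ((isIsomorphic_sigmaPiPeriod_compEquiv Ψ e).isIsogenous.exists_finset_addSubmonoidClosure_eq_iff _ _).2 h

end Ascend

/-! ### §4 Thm. 4.2 -/

section ThmFourTwo

variable {κ : Type*} [Fintype κ] [DecidableEq κ] {σ : κ → Type*} [∀ k, Fintype (σ k)]
  [∀ k, DecidableEq (σ k)] {F : κ → Type*} [∀ k, NormedAddCommGroup (F k)] [∀ k, NormedSpace ℂ (F k)]
  (Ψ : ∀ k, (σ k → ℝ) ≃L[ℝ] F k)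

/-- **Thm. 4.2 for a product of simple factors (Bauer's (ic) ⟺ (ii) on `X₁ × ⋯ × X_r`)**: for SIMPLE
complex abelian varieties `X_k ≠ 0` (`k ∈ κ`), `N(∏_k X_k)` is finitely generated if and only if the `X_k`
are pairwise non-isogenous and `NS(X_k) ≅ ℤ` for every `k`. "Only if": descent to each factor and
Prop. 2.2 (file 50); `X_j ∼ X_k` for `j ≠ k` would give `X_j × X_k ∼ X_k × X_k` with finitely generated `N`,
impossible (Prop. 3.1, file 52). "If": `N(X_k) = ℤ⁺·[M_k]` (file 50) and §3 with
`Hom(X_j, X_k) = 0` (Cor. 2.4.26). [cite: Bauer1998ConeOfCurves, §4 Thm. 4.2 and §1 Theorem ((ic) ⟺ (ii))] -/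
theorem IsSimple.exists_finset_addSubmonoidClosure_eq_sigmaPi_iff [∀ k, Nonempty (σ k)]
    (hS : ∀ k, IsSimple (Ψ k)) (hA : ∀ k, IsAbelianVariety (Ψ k)) :
    (∃ S : Finset ((∀ k, F k) [⋀^Fin 2]→L[ℝ] ℝ),
      (AddSubmonoid.closure (S : Set ((∀ k, F k) [⋀^Fin 2]→L[ℝ] ℝ)) : Set ((∀ k, F k) [⋀^Fin 2]→L[ℝ] ℝ)) =
        {η | IsNSForm (sigmaPiPeriod Ψ) η ∧ ∀ v : ∀ k, F k, 0 ≤ η ![I • v, v]}) ↔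
      (∀ j k, j ≠ k → ¬ IsIsogenous (Ψ j) (Ψ k)) ∧ ∀ k, finrank ℤ (neronSeveriGroup (Ψ k)) = 1 := by
  haveI : ∀ k, Nontrivial (F k) := fun k ↦ Module.nontrivial_of_finrank_pos (finrank_pos_of_nonempty (Ψ k))
  constructor
  · intro h
    refine ⟨fun j k hjk hiso ↦ ?_, fun k ↦ ?_⟩
    · -- `X_j × X_k ∼ X_k × X_k`
      have hpair := exists_finset_addSubmonoidClosure_eq_prod_of_sigmaPi Ψ h hjk
      exact (hiso.prod (IsIsogenous.refl (Ψ k))).not_exists_finset_addSubmonoidClosure_eq_of_prod (Ψ k) (hA k)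
        hpair
    · obtain ⟨S, hSk⟩ := exists_finset_addSubmonoidClosure_eq_of_sigmaPi Ψ h k
      exact (hS k).finrank_neronSeveriGroup_eq_one_of_addSubmonoidClosure_eq (Ψ k) (hA k) hSk
  · rintro ⟨hni, hρ⟩
    refine exists_finset_addSubmonoidClosure_eq_sigmaPi_of_forall_homRat_eq_bot Ψ hA
      (fun j k hjk ↦ (hS j).homRat_eq_bot (hS k) (hni j k hjk)) fun k ↦ ?_
    obtain ⟨M, -, hM⟩ := exists_addSubmonoidClosure_singleton_eq_of_finrank_eq_one (Ψ k) (hA k) (hρ k)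
    refine ⟨{M}, ?_⟩
    rw [Finset.coe_singleton]
    exact hM

/-- **THE THEOREM (ic) ⟺ (ii) for every complex torus isogenous to a product of simple abelian varieties
`X_k ≠ 0`**: `N(X)` is finitely generated iff the `X_k` are mutually non-isogenous with `NS(X_k) ≅ ℤ`
(Lemma 4.1 and the previous theorem). [cite: Bauer1998ConeOfCurves, §1 Theorem ((ic) ⟺ (ii)), §4 Thm. 4.2, Lemma 4.1] -/
theorem IsIsogenous.exists_finset_addSubmonoidClosure_eq_iff_of_sigmaPi [∀ k, Nonempty (σ k)]
    {ι : Type*} [Fintype ι] [DecidableEq ι] {E : Type*} [NormedAddCommGroup E] [NormedSpace ℂ E]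
    {Φ : (ι → ℝ) ≃L[ℝ] E} (h : IsIsogenous Φ (sigmaPiPeriod Ψ)) (hS : ∀ k, IsSimple (Ψ k))
    (hA : ∀ k, IsAbelianVariety (Ψ k)) :
    (∃ S : Finset (E [⋀^Fin 2]→L[ℝ] ℝ),
        (AddSubmonoid.closure (S : Set (E [⋀^Fin 2]→L[ℝ] ℝ)) : Set (E [⋀^Fin 2]→L[ℝ] ℝ)) =
          {η | IsNSForm Φ η ∧ ∀ v : E, 0 ≤ η ![I • v, v]}) ↔
      (∀ j k, j ≠ k → ¬ IsIsogenous (Ψ j) (Ψ k)) ∧ ∀ k, finrank ℤ (neronSeveriGroup (Ψ k)) = 1 := by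
  rw [h.exists_finset_addSubmonoidClosure_eq_iff Φ (sigmaPiPeriod Ψ)]
  exact IsSimple.exists_finset_addSubmonoidClosure_eq_sigmaPi_iff Ψ hS hA

variable {ρ : Type*} [Fintype ρ] [DecidableEq ρ] {τ : ρ → Type*} [∀ ν, Fintype (τ ν)] [∀ ν, DecidableEq (τ ν)]
  {G : ρ → Type*} [∀ ν, NormedAddCommGroup (G ν)] [∀ ν, NormedSpace ℂ (G ν)]
  (X : ∀ ν, (τ ν → ℝ) ≃L[ℝ] G ν) (n : ρ → ℕ)

/-- **Bauer 1998, Thm. 4.2 on the product of powers**: for simple, nonzero, pairwise non-isogenous abelian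
varieties `X_ν` and exponents `n_ν ≥ 1`, the semigroup `N(∏_ν X_ν^{n_ν})` is finitely generated if and only
if `NS(X_ν) ≅ ℤ` and `n_ν = 1` for every `ν`. "Only if": descent to the factor `X_ν^{n_ν}`; `n_ν ≥ 2` is
impossible (§2, Prop. 3.1), so `n_ν = 1`, `X_ν¹ ≅ X_ν`, and Prop. 2.2 (file 50) gives `NS(X_ν) ≅ ℤ`.
"If": `∏ X_ν¹ ∼ ∏ X_ν` and the previous theorem. [cite: Bauer1998ConeOfCurves, §4 Thm. 4.2] -/
theorem exists_finset_addSubmonoidClosure_eq_powers_iff [∀ ν, Nonempty (τ ν)] (hX : ∀ ν, IsSimple (X ν))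
    (hA : ∀ ν, IsAbelianVariety (X ν)) (hXX : ∀ ν ν', ν ≠ ν' → ¬ IsIsogenous (X ν) (X ν'))
    (hn : ∀ ν, 0 < n ν) :
    (∃ S : Finset ((∀ ν, Fin (n ν) → G ν) [⋀^Fin 2]→L[ℝ] ℝ),
      (AddSubmonoid.closure (S : Set ((∀ ν, Fin (n ν) → G ν) [⋀^Fin 2]→L[ℝ] ℝ)) :
          Set ((∀ ν, Fin (n ν) → G ν) [⋀^Fin 2]→L[ℝ] ℝ)) =
        {η | IsNSForm (sigmaPiPeriod fun ν ↦ powPeriod (X ν) (n ν)) η ∧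
          ∀ v : ∀ ν, Fin (n ν) → G ν, 0 ≤ η ![I • v, v]}) ↔
      ∀ ν, finrank ℤ (neronSeveriGroup (X ν)) = 1 ∧ n ν = 1 := by
  haveI : ∀ ν, Nontrivial (G ν) := fun ν ↦ Module.nontrivial_of_finrank_pos (finrank_pos_of_nonempty (X ν))
  constructor
  · intro h ν
    -- descent to the factor `X_ν^{n_ν}`
    have hfac := exists_finset_addSubmonoidClosure_eq_of_sigmaPi (fun ν ↦ powPeriod (X ν) (n ν)) h ν
    have hn1 : n ν = 1 := by
      by_contra hne
      have h2 : 2 ≤ n ν := by have := hn ν; omega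
      exact (hA ν).not_exists_finset_addSubmonoidClosure_eq_powPeriod (X ν) h2 hfac
    refine ⟨?_, hn1⟩
    obtain ⟨S, hS⟩ := exists_finset_addSubmonoidClosure_eq_of_powPeriod_of_eq_one (X ν) hn1 hfac
    exact (hX ν).finrank_neronSeveriGroup_eq_one_of_addSubmonoidClosure_eq (X ν) (hA ν) hS
  · intro h
    have hn1 : n = fun _ ↦ 1 := funext fun ν ↦ (h ν).2
    subst hn1
    have iso : IsIsogenous (sigmaPiPeriod fun ν ↦ powPeriod (X ν) ((fun _ : ρ ↦ 1) ν)) (sigmaPiPeriod X) :=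
      IsIsogenous.sigmaPi _ _ fun ν ↦ (isIsomorphic_powPeriod_one (X ν)).symm.isIsogenous
    rw [iso.exists_finset_addSubmonoidClosure_eq_iff _ _,
      IsSimple.exists_finset_addSubmonoidClosure_eq_sigmaPi_iff X hX hA]
    exact ⟨hXX, fun ν ↦ (h ν).1⟩

/-- **Thm. 4.2 along a Poincaré decomposition, isogeny-class form**: if `X ∼ ∏_ν X_ν^{n_ν}` with simple,
nonzero, pairwise non-isogenous abelian varieties `X_ν` and `n_ν ≥ 1`, then `N(X)` is finitely generated iff
`NS(X_ν) ≅ ℤ` and `n_ν = 1` for every `ν`. [cite: Bauer1998ConeOfCurves, §4 Thm. 4.2, Lemma 4.1] -/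
theorem IsIsogenous.exists_finset_addSubmonoidClosure_eq_iff_of_powers [∀ ν, Nonempty (τ ν)]
    {ι : Type*} [Fintype ι] [DecidableEq ι] {E : Type*} [NormedAddCommGroup E] [NormedSpace ℂ E]
    {Φ : (ι → ℝ) ≃L[ℝ] E} (hiso : IsIsogenous Φ (sigmaPiPeriod fun ν ↦ powPeriod (X ν) (n ν)))
    (hX : ∀ ν, IsSimple (X ν)) (hA : ∀ ν, IsAbelianVariety (X ν))
    (hXX : ∀ ν ν', ν ≠ ν' → ¬ IsIsogenous (X ν) (X ν')) (hn : ∀ ν, 0 < n ν) :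
    (∃ S : Finset (E [⋀^Fin 2]→L[ℝ] ℝ),
        (AddSubmonoid.closure (S : Set (E [⋀^Fin 2]→L[ℝ] ℝ)) : Set (E [⋀^Fin 2]→L[ℝ] ℝ)) =
          {η | IsNSForm Φ η ∧ ∀ v : E, 0 ≤ η ![I • v, v]}) ↔
      ∀ ν, finrank ℤ (neronSeveriGroup (X ν)) = 1 ∧ n ν = 1 := by
  rw [hiso.exists_finset_addSubmonoidClosure_eq_iff Φ _]
  exact exists_finset_addSubmonoidClosure_eq_powers_iff X n hX hA hXX hn

/-- **Bauer 1998, Theorem 4.2, as printed.** "Consider an arbitrary abelian variety `X`. It is isogenous to a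
product `X₁^{n₁} × … × X_r^{n_r}` with integers `nᵢ ≥ 1`, where the `Xᵢ` are simple and mutually
non-isogenous abelian varieties. **The semi-group `N(X)` is finitely generated if and only if `NS(Xᵢ) ≅ ℤ`
and `nᵢ = 1` for `1 ≤ i ≤ r`.**" Here `N(X) = {η ∈ NS(X) | H_η ≥ 0}` is the semigroup of effective
(= semi-positive = nef) classes, the decomposition is any isogeny `X ∼ ∏_ν X_ν^{n_ν}` with simple, nonzero,
pairwise non-isogenous tori `X_ν` and `n_ν ≥ 1` (it exists, `poincare_complete_reducibility_powers`, and is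
unique), and the `X_ν` are abelian varieties because `X` is (`IsAbelianVariety.of_isIsogenous_powers`).
[cite: Bauer1998ConeOfCurves, §4 Thm. 4.2] [cite: Lange2023AbelianVarietiesComplex, §2.4.4 Thm. 2.4.25] -/
theorem IsAbelianVariety.exists_finset_addSubmonoidClosure_eq_iff_of_isIsogenous_powers [∀ ν, Nonempty (τ ν)]
    {ι : Type*} [Fintype ι] [DecidableEq ι] {E : Type*} [NormedAddCommGroup E] [NormedSpace ℂ E]
    {A : (ι → ℝ) ≃L[ℝ] E} (hAV : IsAbelianVariety A)
    (hiso : IsIsogenous A (sigmaPiPeriod fun ν ↦ powPeriod (X ν) (n ν))) (hX : ∀ ν, IsSimple (X ν))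
    (hXX : ∀ ν ν', ν ≠ ν' → ¬ IsIsogenous (X ν) (X ν')) (hn : ∀ ν, 0 < n ν) :
    (∃ S : Finset (E [⋀^Fin 2]→L[ℝ] ℝ),
        (AddSubmonoid.closure (S : Set (E [⋀^Fin 2]→L[ℝ] ℝ)) : Set (E [⋀^Fin 2]→L[ℝ] ℝ)) =
          {η | IsNSForm A η ∧ ∀ v : E, 0 ≤ η ![I • v, v]}) ↔
      ∀ ν, finrank ℤ (neronSeveriGroup (X ν)) = 1 ∧ n ν = 1 :=
  hiso.exists_finset_addSubmonoidClosure_eq_iff_of_powers X n hX (hAV.of_isIsogenous_powers X n hiso hn) hXX hn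

end ThmFourTwo

end ComplexTorus

end Literature.Geometry.Kaehler

end
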